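import Summits.Ventures.Crystal3D.Theorems.StickyWulffConstantPolycrystalWulffBoundRungInclinedShift

/-!
# `PolycrystalWulffBound`, line `PolyDensity`: the named computational hypothesis `TwinSectionShift c` and
# the rung `rung_inclinedLamellar_twin` — inclined lamellar TWIN textures satisfy
# `6·2^{1/3}(√2·Vol)^{2/3} ≤ Fr + c·sin∠(n,m)·Σ_f S_f` (crux `stmt-Ventures-19482`)

Route `StickyWulffConstant` of the venture `Summits/Ventures/Crystal3D`, second prover lane (poly-p2,
gen 8).  The charge-free rungs (`rung_zone`, `rung_columnar`, `rung_basalLamellar`) need no numerics; the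
general inclination needs ONE number: the section-shift constant `c` of the truncated octahedron against its
twin (`TwinSectionShift c`, stated over all co-axial frame pairs and all normals so that it plugs into
`rung_inclinedLamellar_of_cdfShift` directly; numerically `c = 1/√6` works, memo P-TWIN-g8 table 2a).  With
`c ≤ 1/2` and `S_f = |wall_f|` the right-hand side is at most the crux's energy `En` (wall charge
`½·sin∠(n,m)·area`), i.e. P for inclined lamellar twins.
WHAT THIS IS NOT: a proof of `TwinSectionShift (1/√6)` (kit-certifiable 1-D computation) nor of
`S_f = |wall_f|`; the crux is not claimed. -/

noncomputable section

open scoped BigOperators InnerProductSpace ENNReal Pointwise Topology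
open MeasureTheory Filter Set

namespace Summit.Ventures.Crystal3D.Cruxes.PolycrystalWulffBound.PolyDensity

open Summit.Ventures.Crystal3D.Theorems
open Summit.Ventures.Crystal3D.Cruxes.TextureLiminf.TexShadow (per polytope E3)
open Literature.MathematicalPhysics.StatisticalMechanics (fccStacking barlowStacking IsHaggSeq perimeter)

/-- **Twin section-shift constant** `c` (computational hypothesis, seat memo P-TWIN-g8 §2a/§5b): for every
co-axial pair of frames `A, B` (crux clause `Ax m A B`, so `W(B) ∈ {W(A), R_m '' W(A)}`) and every unit
normal `n`, the cumulative section volumes of the two Wulff bodies along `n` are shifts of each other by at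
most `c · sin∠(n, m)`: `|W(B) ∩ {⟪y,n⟫ < t}| ≤ |W(A) ∩ {⟪y,n⟫ < t + c·√(1 − ⟪n,m⟫²)}|` for all `t`.
Numerically the smallest admissible `c` is `1/√6 = 0.408…` (attained at the `⟨111⟩′` poles); the crux's
co-axial wall charge is `c₁ = 1/2`. -/
def TwinSectionShift (c : ℝ) : Prop :=
    let Λ : Set (EuclideanSpace ℝ (Fin 3)) := Literature.MathematicalPhysics.StatisticalMechanics.fccStacking 1 (Real.sqrt (2 / 3)); let Brl : (ℤ → ℤ) → Set (EuclideanSpace ℝ (Fin 3)) := Literature.MathematicalPhysics.StatisticalMechanics.barlowStacking 1 (Real.sqrt (2 / 3)); let Ax : EuclideanSpace ℝ (Fin 3) → (EuclideanSpace ℝ (Fin 3) ≃ₗᵢ[ℝ] EuclideanSpace ℝ (Fin 3)) → (EuclideanSpace ℝ (Fin 3) ≃ₗᵢ[ℝ] EuclideanSpace ℝ (Fin 3)) → Prop := fun m A B => ∃ (L : EuclideanSpace ℝ (Fin 3) ≃ₗᵢ[ℝ] EuclideanSpace ℝ (Fin 3)) (s₁ s₂ : EuclideanSpace ℝ (Fin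 3)) (σ σ' : ℤ → ℤ), Literature.MathematicalPhysics.StatisticalMechanics.IsHaggSeq σ ∧ Literature.MathematicalPhysics.StatisticalMechanics.IsHaggSeq σ' ∧ L (EuclideanSpace.single (2 : Fin 3) (1 : ℝ)) = m ∧ A '' Λ ⊆ (fun q => L q + s₁) '' Brl σ ∧ B '' Λ ⊆ (fun q => L q + s₂) '' Brl σ'; let Φ : EuclideanSpace ℝ (Fin 3) → ℝ := fun ν => Real.sqrt 2 / 4 * ∑ᶠ w ∈ {w ∈ Λ | ‖w‖ = 1}, |⟪w, ν⟫_ℝ|; let W : (EuclideanSpace ℝ (Fin 3) ≃ₗᵢ[ℝ] EuclideanSpace ℝ (Fin 3)) → Set (EuclideanSpace ℝ (Fin 3)) := fun A => {y | ∀ ν : EuclideanSpace ℝ (Fin 3), ⟪y, ν⟫_ℝ ≤ Φ (A.symm ν)}; ∀ (m : EuclideanSpace ℝ (Fin 3)) (A B : EuclideanSpace ℝ (Fin 3) ≃ₗᵢ[ℝ] EuclideanSpace ℝ (Fin 3)), Ax m A B →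
      ∀ (n : EuclideanSpace ℝ (Fin 3)), ‖n‖ = 1 → ∀ t : ℝ,
        volume (W B ∩ {y | ⟪y, n⟫_ℝ < t}) ≤ volume (W A ∩ {y | ⟪y, n⟫_ℝ < t + c * Real.sqrt (1 - ⟪n, m⟫_ℝ ^ 2)})

/-- **Rung `rung_inclinedLamellar_twin`**: under `TwinSectionShift c`, a polyhedral set cut by parallel
planes of any unit normal `n` into lamellae with pairwise co-axial frames (axis `m`) satisfies
`6·2^{1/3}(√2·Vol)^{2/3} ≤ Fr + c·sin∠(n,m)·Σ_f S_f` (`S_f` one-sided section bounds at the walls). -/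
theorem rung_inclinedLamellar_twin {c : ℝ} (hc : 0 ≤ c) (hTS : TwinSectionShift c) :
    let Λ : Set (EuclideanSpace ℝ (Fin 3)) := Literature.MathematicalPhysics.StatisticalMechanics.fccStacking 1 (Real.sqrt (2 / 3)); let Brl : (ℤ → ℤ) → Set (EuclideanSpace ℝ (Fin 3)) := Literature.MathematicalPhysics.StatisticalMechanics.barlowStacking 1 (Real.sqrt (2 / 3)); let Ax : EuclideanSpace ℝ (Fin 3) → (EuclideanSpace ℝ (Fin 3) ≃ₗᵢ[ℝ] EuclideanSpace ℝ (Fin 3)) → (EuclideanSpace ℝ (Fin 3) ≃ₗᵢ[ℝ] EuclideanSpace ℝ (Fin 3)) → Prop := fun m A B => ∃ (L : EuclideanSpace ℝ (Fin 3) ≃ₗᵢ[ℝ] EuclideanSpace ℝ (Fin 3)) (s₁ s₂ : EuclideanSpace ℝ (Fin 3)) (σ σ' : ℤ → ℤ), Literature.MathematicalPhysics.StatisticalMechanics.IsHaggSeq σ ∧ Literature.MathematicalPhysics.StatisticalMechanics.IsHaggSeq σ' ∧ L (EuclideanSpace.single (2 : Fin 3) (1 : ℝ)) = m ∧ A ''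 Λ ⊆ (fun q => L q + s₁) '' Brl σ ∧ B '' Λ ⊆ (fun q => L q + s₂) '' Brl σ'; let Φ : EuclideanSpace ℝ (Fin 3) → ℝ := fun ν => Real.sqrt 2 / 4 * ∑ᶠ w ∈ {w ∈ Λ | ‖w‖ = 1}, |⟪w, ν⟫_ℝ|; let Per : Set (EuclideanSpace ℝ (Fin 3)) → Set (EuclideanSpace ℝ (Fin 3)) → ℝ := fun K S => (⨆ (ξ : EuclideanSpace ℝ (Fin 3) → EuclideanSpace ℝ (Fin 3)) (_ : ContDiff ℝ 1 ξ ∧ HasCompactSupport ξ ∧ ∀ z, ξ z ∈ K), ENNReal.ofReal (∫ z in S, Literature.MathematicalPhysics.StatisticalMechanics.fieldDivergence ξ z)).toReal; let ι : Set (EuclideanSpace ℝ (Fin 3)) → Set (EuclideanSpace ℝ (Fin 3)) → Set (EuclideanSpace ℝ (Fin 3)) → ℝ := fun K S₁ S₂ => (Per K S₁ + Per K S₂ - Per K (S₁ ∪ S₂)) / 2; let W : (EuclideanSpace ℝ (Fin 3) ≃ₗᵢ[ℝ] EuclideanSpace ℝ (Fin 3)) → Set (EuclideanSpace ℝ (Fin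 3)) := fun A => {y | ∀ ν : EuclideanSpace ℝ (Fin 3), ⟪y, ν⟫_ℝ ≤ Φ (A.symm ν)}; let Vol : (n : ℕ) → (Fin n → Set (EuclideanSpace ℝ (Fin 3))) → ℝ := fun n G => (volume (⋃ f : Fin n, G f)).toReal; let Poly : Set (EuclideanSpace ℝ (Fin 3)) → Prop := fun S => ∃ (k : ℕ) (H : Fin k → Finset ((EuclideanSpace ℝ (Fin 3)) × ℝ)), S = ⋃ i, ⋂ p ∈ H i, {x | ⟪p.1, x⟫_ℝ < p.2}; let Fr : (n : ℕ) → (Fin n → Set (EuclideanSpace ℝ (Fin 3))) → (Fin n → (EuclideanSpace ℝ (Fin 3) ≃ₗᵢ[ℝ] EuclideanSpace ℝ (Fin 3))) → ℝ := fun n G A => ∑ f : Fin n, Per (W (A f)) (G f) - ∑ f, ∑ g, (if f = g then 0 else ι (W (A f)) (G f) (G g)); ∀ (E : Set (EuclideanSpace ℝ (Fin 3))), Poly E → volume E < ⊤ → ∀ (m n : EuclideanSpace ℝ (Fin 3)), ‖n‖ = 1 → ∀ (k : ℕ) (a : Fin (k + 1) → ℝ), StrictMono a → ∀ (A : Fin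 k → (EuclideanSpace ℝ (Fin 3) ≃ₗᵢ[ℝ] EuclideanSpace ℝ (Fin 3))) (S : Fin k → ℝ), (∀ f g, Ax m (A f) (A g)) → (∀ f, 0 ≤ S f) → (∀ f (h : ℝ), 0 < h → volume (E ∩ {x | a f.succ - h ≤ ⟪x, n⟫_ℝ ∧ ⟪x, n⟫_ℝ < a f.succ}) ≤ ENNReal.ofReal (h * S f)) → 6 * (2 : ℝ) ^ ((1 : ℝ) / 3) * (Real.sqrt 2 * Vol k (fun f => E ∩ {x | a f.castSucc < ⟪x, n⟫_ℝ ∧ ⟪x, n⟫_ℝ < a f.succ})) ^ ((2 : ℝ) / 3) ≤ Fr k (fun f => E ∩ {x | a f.castSucc < ⟪x, n⟫_ℝ ∧ ⟪x, n⟫_ℝ < a f.succ}) A + c * Real.sqrt (1 - ⟪n, m⟫_ℝ ^ 2) * ∑ f, S f := by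
  intro Λ Brl Ax Φ Per ι W Vol Poly Fr E hE hEv m n hn k a ha A S hAx hS0 hS
  have hδ : 0 ≤ c * Real.sqrt (1 - ⟪n, m⟫_ℝ ^ 2) := mul_nonneg hc (Real.sqrt_nonneg _)
  have hshift : ∀ (f g : Fin k), (f : ℕ) + 1 = g → ∀ t : ℝ,
      volume (W (A g) ∩ {y | ⟪y, n⟫_ℝ < t}) ≤
        volume (W (A f) ∩ {y | ⟪y, n⟫_ℝ < t + c * Real.sqrt (1 - ⟪n, m⟫_ℝ ^ 2)}) :=
    fun f g _ t => hTS m (A f) (A g) (hAx f g) n hn t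
  exact rung_inclinedLamellar_of_cdfShift E hE hEv n hn k a ha A (c * Real.sqrt (1 - ⟪n, m⟫_ℝ ^ 2)) S
    hδ hshift hS0 hS

end Summit.Ventures.Crystal3D.Cruxes.PolycrystalWulffBound.PolyDensity

end
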